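import Mathlib

/-!
# `FidelityWitnesses.LinearDefectLaw` (stmt-MatrixMultiplication-14039) — the `2 × 2` cyclic trace inequality, I: frames of `ℂ²`
# and the singular frame of a `2 × 2` matrix`

Support file for item `stmt-MatrixMultiplication-14039` (`LinearDefectLaw`) of route `MatrixMultiplication/FidelityWitnesses`:
the analytic core of the law's rank-3 rung at `n = 2` (`M(2,3) ≤ 4`).  After deflating `T = ⟨2,2,2⟩` in all three slots by unit
functionals `α, β, γ` (`…LinearDefectLawSlotDeflation`), `‖(P_{α⊥}⊗P_{β⊥}⊗P_{γ⊥})T‖² = 2 + f` with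
`f = ‖AᵀB‖² + ‖BC‖² + ‖CAᵀ‖² − |tr(AᵀBC)|²` for the unit `2 × 2` matrices `A = conj α`, `B = conj β`, `C = conj γ`; this file
and its sequel `…TraceIneq` prove `f ≤ 2` for ALL unit-Frobenius `A, B, C : ℂ^{2×2}` (matrices as `Fin 2 → Fin 2 → ℂ`).
THIS FILE (part I): the linear algebra of orthonormal pairs of `ℂ²` as plain functions — rotation to an orthonormal pair
(`isONB_of_unit`), adapted frames (`exists_frame`), completeness via `mul_eq_one_comm` (`complete_of_isONB`), Parseval in one and two
frames (`parseval_conj`, `parseval`, `parseval₂`), and the SINGULAR FRAME of a `2 × 2` matrix (`exists_singular_frame`, registered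
stub `stub_singularFrame`): orthonormal `u, v` with `u_iᴴ B v_j = 0` for `i ≠ j`, from an orthonormal eigenbasis of `BᴴB`
(`Matrix.IsHermitian.eigenvectorBasis`).  The sequel proves the inequality from it:

PROOF.  In a singular frame of `B` — orthonormal pairs `u` (left), `v` (right) of `ℂ²` with `u_iᴴ B v_j = 0` for `i ≠ j`
(`exists_singular_frame`, from an orthonormal eigenbasis of `BᴴB`, Mathlib's `Matrix.IsHermitian.eigenvectorBasis`) — write
`b_j = u_jᴴBv_j`, `c_j = ‖Au_j‖²`, `ρ_j = ‖v_jᴴC‖²`, `M_{ij} = v_iᴴ C Aᵀ u_j`.  Parseval in these frames gives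
`‖AᵀB‖² = Σ|b_j|²c_j`, `‖BC‖² = Σ|b_j|²ρ_j`, `‖CAᵀ‖² = Σ|M_{ij}|²`, `tr = Σ b_jM_{jj}`, `Σc_j = Σρ_j = Σ|b_j|² = 1`, and
Cauchy–Schwarz `|M_{ij}|² ≤ ρ_ic_j`; the unitary identity `|b₀M₀₀+b₁M₁₁|² + |b̄₁M₀₀ − b̄₀M₁₁|² = (Σ|b_j|²)(|M₀₀|²+|M₁₁|²)`
reduces `2 − f ≥ 0` to `2|b₁|²ρ₀c₀ + 2|b₀|²ρ₁c₁ ≥ (|b₁||M₀₀| + |b₀||M₁₁|)²`, i.e. to `(|b₁||M₀₀| − |b₀||M₁₁|)² ≥ 0` plus the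
Cauchy–Schwarz slacks (`scalar_core`, `nlinarith`).  Pure Mathlib; no definitions.
-/

noncomputable section

namespace Summit.MatrixMultiplication.MatrixMultiplication.Theorems.LinearDefectLaw.TraceIneq

open scoped BigOperators ComplexConjugate

set_option linter.dupNamespace false

/-! ## Orthonormal pairs in `ℂ²` -/

/-- a unit vector and its rotation form an orthonormal pair -/
theorem isONB_of_unit (w : Fin 2 → ℂ) (hw : ∑ k, ‖w k‖ ^ 2 = 1) :
    ∀ i j, ∑ k, conj ((![w, ![-conj (w 1), conj (w 0)]] : Fin 2 → Fin 2 → ℂ) i k) *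
      (![w, ![-conj (w 1), conj (w 0)]] : Fin 2 → Fin 2 → ℂ) j k = if i = j then (1 : ℂ) else 0 := by
  have hw' : conj (w 0) * w 0 + conj (w 1) * w 1 = 1 := by
    rw [Complex.conj_mul', Complex.conj_mul', ← Complex.ofReal_pow, ← Complex.ofReal_pow, ← Complex.ofReal_add]
    simp only [Fin.sum_univ_two, Fin.isValue] at hw
    rw [hw, Complex.ofReal_one]
  intro i j
  fin_cases i <;> fin_cases j
  · simpa [Fin.sum_univ_two] using hw'
  · simp [Fin.sum_univ_two]; ring
  · simp [Fin.sum_univ_two]; ring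
  · simp [Fin.sum_univ_two]
    linear_combination hw'

/-- swapping the two vectors of an orthonormal pair -/
theorem isONB_swap {u : Fin 2 → Fin 2 → ℂ} (hu : ∀ i j, ∑ k, conj (u i k) * u j k = if i = j then (1 : ℂ) else 0) :
    ∀ i j, ∑ k, conj ((![u 1, u 0] : Fin 2 → Fin 2 → ℂ) i k) * (![u 1, u 0] : Fin 2 → Fin 2 → ℂ) j k =
      if i = j then (1 : ℂ) else 0 := by
  intro i j
  fin_cases i <;> fin_cases j
  · simpa using hu 1 1
  · simpa using hu 1 0
  · simpa using hu 0 1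
  · simpa using hu 0 0

/-- normalising a non-zero vector of `ℂ²` -/
theorem exists_unit_smul {p : Fin 2 → ℂ} (hp : p ≠ 0) :
    ∃ (r : ℝ) (w : Fin 2 → ℂ), 0 < r ∧ (∑ k, ‖w k‖ ^ 2 = 1) ∧ ∀ k, p k = (r : ℂ) * w k := by
  have hpos : 0 < ∑ k, ‖p k‖ ^ 2 := by
    obtain ⟨k, hk⟩ : ∃ k, p k ≠ 0 := by
      by_contra h
      push Not at h
      exact hp (funext h)
    exact lt_of_lt_of_le (by positivity) (Finset.single_le_sum (f := fun k => ‖p k‖ ^ 2)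
      (fun i _ => by positivity) (Finset.mem_univ k))
  set r : ℝ := Real.sqrt (∑ k, ‖p k‖ ^ 2) with hr
  have hrpos : 0 < r := Real.sqrt_pos.2 hpos
  have hr2 : r ^ 2 = ∑ k, ‖p k‖ ^ 2 := Real.sq_sqrt hpos.le
  refine ⟨r, fun k => p k / r, hrpos, ?_, fun k => ?_⟩
  · have h : ∀ k, ‖p k / (r : ℂ)‖ ^ 2 = ‖p k‖ ^ 2 / r ^ 2 := fun k => by
      rw [norm_div, Complex.norm_real, Real.norm_of_nonneg hrpos.le, div_pow]
    simp only [h]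
    rw [← Finset.sum_div, ← hr2]
    exact div_self (pow_pos hrpos 2).ne'
  · field_simp [hrpos.ne']

/-- **Adapted frame.** For two orthogonal vectors `p, q` of `ℂ²` there is an orthonormal pair `u` with `u 1 ⊥ p` and
`u 0 ⊥ q` (take `u 0 ∥ p` if `p ≠ 0`, else `u 1 ∥ q`). -/
theorem exists_frame (p q : Fin 2 → ℂ) (hpq : ∑ k, conj (p k) * q k = 0) :
    ∃ u : Fin 2 → Fin 2 → ℂ, (∀ i j, ∑ k, conj (u i k) * u j k = if i = j then (1 : ℂ) else 0) ∧
      (∑ k, conj (u 1 k) * p k = 0) ∧ (∑ k, conj (u 0 k) * q k = 0) := by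
  by_cases hp : p = 0
  · by_cases hq : q = 0
    · refine ⟨![![1, 0], ![0, 1]], ?_, by simp [hp], by simp [hq]⟩
      intro i j
      fin_cases i <;> fin_cases j <;> simp [Fin.sum_univ_two]
    · obtain ⟨r, w, _, hw, hqw⟩ := exists_unit_smul hq
      refine ⟨![![-conj (w 1), conj (w 0)], w], isONB_swap (isONB_of_unit w hw), by simp [hp], ?_⟩
      have h0 := isONB_of_unit w hw 1 0
      simp only [Fin.isValue, Matrix.cons_val_one, Matrix.cons_val_zero, one_ne_zero, if_false,
        Matrix.cons_val_fin_one] at h0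
      show ∑ k, conj ((![-conj (w 1), conj (w 0)] : Fin 2 → ℂ) k) * q k = 0
      simp_rw [hqw, ← mul_assoc, mul_comm _ (r : ℂ), mul_assoc, ← Finset.mul_sum, h0, mul_zero]
  · obtain ⟨r, w, _, hw, hpw⟩ := exists_unit_smul hp
    refine ⟨![w, ![-conj (w 1), conj (w 0)]], isONB_of_unit w hw, ?_, ?_⟩
    · have h0 := isONB_of_unit w hw 1 0
      simp only [Fin.isValue, Matrix.cons_val_one, Matrix.cons_val_zero, one_ne_zero, if_false,
        Matrix.cons_val_fin_one] at h0
      show ∑ k, conj ((![-conj (w 1), conj (w 0)] : Fin 2 → ℂ) k) * p k = 0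
      simp_rw [hpw, ← mul_assoc, mul_comm _ (r : ℂ), mul_assoc, ← Finset.mul_sum, h0, mul_zero]
    · show ∑ k, conj (w k) * q k = 0
      have h : ∑ k, conj (p k) * q k = (r : ℂ) * ∑ k, conj (w k) * q k := by
        rw [Finset.mul_sum]
        exact Finset.sum_congr rfl fun k _ => by rw [hpw k, map_mul, Complex.conj_ofReal]; ring
      rw [h] at hpq
      rcases mul_eq_zero.1 hpq with h1 | h1
      · exact absurd (by exact_mod_cast h1) (ne_of_gt ‹0 < r›)
      · exact h1

/-- **Completeness of an orthonormal pair of `ℂ²`** (resolution of the identity): `Σ_j u j k · conj(u j l) = δ_{kl}`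
(a `2 × 2` matrix with orthonormal columns is unitary). -/
theorem complete_of_isONB {u : Fin 2 → Fin 2 → ℂ} (hu : ∀ i j, ∑ k, conj (u i k) * u j k = if i = j then (1 : ℂ) else 0) (k l : Fin 2) :
    ∑ j, u j k * conj (u j l) = if k = l then 1 else 0 := by
  let U : Matrix (Fin 2) (Fin 2) ℂ := Matrix.of fun k j => u j k
  have h1 : U.conjTranspose * U = 1 := by
    ext i j
    rw [Matrix.mul_apply]
    have := hu i j
    simp only [Matrix.conjTranspose_apply, Matrix.of_apply, Matrix.one_apply, U] at this ⊢
    simpa using this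
  have h2 : U * U.conjTranspose = 1 := mul_eq_one_comm.1 h1
  have := congr_fun (congr_fun h2 k) l
  rw [Matrix.mul_apply] at this
  simpa [Matrix.conjTranspose_apply, Matrix.of_apply, Matrix.one_apply, U] using this

/-- **Parseval** (conjugate form) for an orthonormal pair of `ℂ²`: `Σ_j |⟨u_j, w⟩|² = ‖w‖²`. -/
theorem parseval_conj {u : Fin 2 → Fin 2 → ℂ} (hu : ∀ i j, ∑ k, conj (u i k) * u j k = if i = j then (1 : ℂ) else 0) (w : Fin 2 → ℂ) :
    ∑ j, ‖∑ k, conj (u j k) * w k‖ ^ 2 = ∑ k, ‖w k‖ ^ 2 := by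
  have key : ∀ j, ((‖∑ k, conj (u j k) * w k‖ ^ 2 : ℝ) : ℂ) =
      ∑ k, ∑ l, (conj (w k) * w l) * (u j k * conj (u j l)) := by
    intro j
    rw [Complex.ofReal_pow, ← Complex.conj_mul', map_sum, Finset.sum_mul]
    refine Finset.sum_congr rfl fun k _ => ?_
    rw [Finset.mul_sum]
    refine Finset.sum_congr rfl fun l _ => ?_
    simp only [map_mul, Complex.conj_conj]
    ring
  apply Complex.ofReal_injective
  rw [Complex.ofReal_sum, Complex.ofReal_sum]
  simp_rw [key]
  rw [Finset.sum_comm]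
  refine Finset.sum_congr rfl fun k _ => ?_
  rw [Finset.sum_comm, Finset.sum_eq_single k]
  · rw [← Finset.mul_sum, complete_of_isONB hu k k, if_pos rfl, mul_one, Complex.conj_mul', Complex.ofReal_pow]
  · intro l _ hlk
    rw [← Finset.mul_sum, complete_of_isONB hu k l, if_neg (Ne.symm hlk), mul_zero]
  · intro h; exact absurd (Finset.mem_univ k) h

/-- **Parseval** (bilinear form): `Σ_j |Σ_k u_j k · w k|² = ‖w‖²`. -/
theorem parseval {u : Fin 2 → Fin 2 → ℂ} (hu : ∀ i j, ∑ k, conj (u i k) * u j k = if i = j then (1 : ℂ) else 0) (w : Fin 2 → ℂ) :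
    ∑ j, ‖∑ k, u j k * w k‖ ^ 2 = ∑ k, ‖w k‖ ^ 2 := by
  have h := parseval_conj hu (fun k => conj (w k))
  have e : ∀ j, ‖∑ k, conj (u j k) * conj (w k)‖ = ‖∑ k, u j k * w k‖ := fun j => by
    rw [← Complex.norm_conj (∑ k, u j k * w k), map_sum]
    simp only [map_mul]
  simp only [e, Complex.norm_conj] at h
  exact h

/-- **Double Parseval**: the Frobenius norm of a `2 × 2` matrix in a pair of orthonormal frames,
`Σ_{μκ} |N μ κ|² = Σ_{ij} |Σ_{μκ} conj(v_i μ) N μ κ u_j κ|²`. -/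
theorem parseval₂ {u v : Fin 2 → Fin 2 → ℂ}
    (hu : ∀ i j, ∑ k, conj (u i k) * u j k = if i = j then (1 : ℂ) else 0)
    (hv : ∀ i j, ∑ k, conj (v i k) * v j k = if i = j then (1 : ℂ) else 0) (N : Fin 2 → Fin 2 → ℂ) :
    ∑ μ, ∑ κ, ‖N μ κ‖ ^ 2 = ∑ i, ∑ j, ‖∑ μ, ∑ κ, conj (v i μ) * N μ κ * u j κ‖ ^ 2 := by
  have h1 : ∀ μ, ∑ κ, ‖N μ κ‖ ^ 2 = ∑ j, ‖∑ κ, u j κ * N μ κ‖ ^ 2 := fun μ => (parseval hu (N μ)).symm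
  simp_rw [h1]
  rw [Finset.sum_comm]
  have h2 : ∀ j, ∑ μ, ‖∑ κ, u j κ * N μ κ‖ ^ 2 = ∑ i, ‖∑ μ, conj (v i μ) * ∑ κ, u j κ * N μ κ‖ ^ 2 :=
    fun j => (parseval_conj hv (fun μ => ∑ κ, u j κ * N μ κ)).symm
  simp_rw [h2]
  rw [Finset.sum_comm]
  refine Finset.sum_congr rfl fun i _ => Finset.sum_congr rfl fun j _ => ?_
  congr 2
  refine Finset.sum_congr rfl fun μ _ => ?_
  rw [Finset.mul_sum]
  exact Finset.sum_congr rfl fun κ _ => by ring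

/-- **Singular frame of a `2 × 2` matrix.** For every `B : ℂ^{2×2}` there are orthonormal pairs `u` (left) and `v` (right)
with `u_iᴴ B v_j = 0` for `i ≠ j` (from an orthonormal eigenbasis of `BᴴB`). -/
theorem exists_singular_frame (B : Fin 2 → Fin 2 → ℂ) :
    ∃ u v : Fin 2 → Fin 2 → ℂ, (∀ i j, ∑ k, conj (u i k) * u j k = if i = j then (1 : ℂ) else 0) ∧
      (∀ i j, ∑ k, conj (v i k) * v j k = if i = j then (1 : ℂ) else 0) ∧
      (∑ κ, conj (u 1 κ) * ∑ μ, B κ μ * v 0 μ = 0) ∧ (∑ κ, conj (u 0 κ) * ∑ μ, B κ μ * v 1 μ = 0) := by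
  classical
  let H : Matrix (Fin 2) (Fin 2) ℂ := Matrix.of fun μ μ' => ∑ κ, conj (B κ μ) * B κ μ'
  have hH : H.IsHermitian := by
    ext μ μ'
    simp only [Matrix.conjTranspose_apply, Matrix.of_apply, H, star_sum, star_mul', Complex.star_def,
      Complex.conj_conj]
    exact Finset.sum_congr rfl fun κ _ => mul_comm _ _
  let v : Fin 2 → Fin 2 → ℂ := fun j => ⇑(hH.eigenvectorBasis j)
  have hv : ∀ i j, ∑ k, conj (v i k) * v j k = if i = j then (1 : ℂ) else 0 := by
    intro i j
    have h := hH.eigenvectorBasis.orthonormal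
    rw [orthonormal_iff_ite] at h
    have hij := h i j
    rw [EuclideanSpace.inner_eq_star_dotProduct] at hij
    simpa [dotProduct, mul_comm] using hij
  have heig : ∀ j μ, ∑ μ', H μ μ' * v j μ' = (hH.eigenvalues j : ℂ) * v j μ := by
    intro j μ
    have := congr_fun (hH.mulVec_eigenvectorBasis j) μ
    simpa [Matrix.mulVec, dotProduct] using this
  -- the images `B v 0 ⊥ B v 1`
  have horth : ∑ κ, conj (∑ μ, B κ μ * v 0 μ) * ∑ μ, B κ μ * v 1 μ = 0 := by
    have lhs : ∑ κ, conj (∑ μ, B κ μ * v 0 μ) * ∑ μ, B κ μ * v 1 μ =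
        ∑ κ, ∑ μ, ∑ μ', conj (B κ μ) * conj (v 0 μ) * B κ μ' * v 1 μ' := by
      refine Finset.sum_congr rfl fun κ _ => ?_
      rw [map_sum, Finset.sum_mul]
      refine Finset.sum_congr rfl fun μ _ => ?_
      rw [Finset.mul_sum]
      refine Finset.sum_congr rfl fun μ' _ => ?_
      rw [map_mul]; ring
    have rhs : ∑ μ, conj (v 0 μ) * ∑ μ', H μ μ' * v 1 μ' =
        ∑ μ, ∑ μ', ∑ κ, conj (B κ μ) * conj (v 0 μ) * B κ μ' * v 1 μ' := by
      refine Finset.sum_congr rfl fun μ _ => ?_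
      rw [Finset.mul_sum]
      refine Finset.sum_congr rfl fun μ' _ => ?_
      simp only [H, Matrix.of_apply, Finset.sum_mul, Finset.mul_sum]
      exact Finset.sum_congr rfl fun κ _ => by ring
    have e1 : ∑ κ, conj (∑ μ, B κ μ * v 0 μ) * ∑ μ, B κ μ * v 1 μ =
        ∑ μ, conj (v 0 μ) * ∑ μ', H μ μ' * v 1 μ' := by
      rw [lhs, rhs, Finset.sum_comm]
      exact Finset.sum_congr rfl fun μ _ => Finset.sum_comm
    rw [e1]
    simp_rw [heig 1]
    have e2 : ∑ μ, conj (v 0 μ) * ((hH.eigenvalues 1 : ℂ) * v 1 μ) =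
        (hH.eigenvalues 1 : ℂ) * ∑ μ, conj (v 0 μ) * v 1 μ := by
      rw [Finset.mul_sum]; exact Finset.sum_congr rfl fun μ _ => by ring
    rw [e2, hv 0 1, if_neg (by decide), mul_zero]
  obtain ⟨u, hu, h10, h01⟩ := exists_frame _ _ horth
  exact ⟨u, v, hu, hv, h10, h01⟩

/-- **Registered stub `stub_singularFrame`** (raw form of `exists_singular_frame`). -/
theorem stub_singularFrame : ∀ B : Fin 2 → Fin 2 → ℂ, ∃ u v : Fin 2 → Fin 2 → ℂ, (∀ i j, (∑ k, (starRingEnd ℂ) (u i k) * u j k) = if i = j then (1 : ℂ) else 0) ∧ (∀ i j, (∑ k, (starRingEnd ℂ) (v i k) * v j k) = if i = j then (1 : ℂ) else 0) ∧ (∑ κ, (starRingEnd ℂ) (u 1 κ) * ∑ μ, B κ μ * v 0 μ) = 0 ∧ (∑ κ, (starRingEnd ℂ) (u 0 κ) * ∑ μ, B κ μ * v 1 μ) = 0 :=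
  fun B => exists_singular_frame B

end Summit.MatrixMultiplication.MatrixMultiplication.Theorems.LinearDefectLaw.TraceIneq

end
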